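import Summits.QuantumFields.YangMills.Theorems.LuscherReductionTwistedTraceScalingBOStiffFibreBilinear
import HarnessLib

/-!
# (B-ST) assembly step 2: the seminorm triangle for a positive semi-definite kernel form — `B(f+g+h) ≤ (√B(f) + √B(g) + √B(h))²`
# (lane A of S-BASE, crux `TwistedTraceScaling` stmt-QuantumFields-20203, C4-CORE, the (B-ST) pen; HANDOFF-g21 ASSEMBLY RECIPE step 2)

After step (A) the tube form is bounded by the form `B` of the (PSD, symmetric) transfer or based-averaged kernel of the based average; the test function is split into its inner, gauge-far
and shell parts, and the three pieces are estimated separately (core: `…BOStiffSlowAssembly`; tails: `…BOStiffTailFP`, `…BOStiffTailShell`).  This file is the elementary glue on an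
arbitrary finite measure space for a bounded measurable symmetric kernel `M` with `0 ≤ ∫∫ fMf`:
★ `kform_add_le` — `∫∫ (f+g)M(f+g) ≤ (√∫∫fMf + √∫∫gMg)²`; ★★ `kform_add_three_le` — the three-term version; `kform_add_three_le_of_le` — with given bounds `B(f) ≤ a²`, `B(g) ≤ b²`,
`B(h) ≤ c²`: `B(f+g+h) ≤ (a+b+c)²`.
HONEST FRAMING: bookkeeping for a stub of a child of the CONDITIONAL route R2b1; (B-ST) OPEN; C4-CORE OPEN; not infinite volume, not a gap, not Clay.
-/

set_option autoImplicit false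

noncomputable section

open MeasureTheory

namespace Summit.QuantumFields.YangMills.Theorems.FemtoTransferGap.StiffDoor

variable {X : Type*} [MeasurableSpace X] {μ : Measure X} [IsFiniteMeasure μ]

section Split

variable {M : X → X → ℝ} {CM : ℝ} (hM : Measurable (Function.uncurry M)) (hMb : ∀ x y, |M x y| ≤ CM) (hsymm : ∀ x y, M x y = M y x)
  (hpsd : ∀ f : X → ℝ, Measurable f → (∃ C : ℝ, ∀ x, |f x| ≤ C) → 0 ≤ ∫ x, ∫ y, f x * M x y * f y ∂μ ∂μ)
include hM hMb hsymm hpsd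

/-- ★ **Two-term seminorm triangle**: `∫∫ (f+g)M(f+g) ≤ (√∫∫fMf + √∫∫gMg)²`. [folklore] -/
theorem kform_add_le {f g : X → ℝ} (hf : Measurable f) {Cf : ℝ} (hCf : ∀ x, |f x| ≤ Cf) (hg : Measurable g) {Cg : ℝ} (hCg : ∀ x, |g x| ≤ Cg) :
    ∫ x, ∫ y, (f x + g x) * M x y * (f y + g y) ∂μ ∂μ ≤
      (Real.sqrt (∫ x, ∫ y, f x * M x y * f y ∂μ ∂μ) + Real.sqrt (∫ x, ∫ y, g x * M x y * g y ∂μ ∂μ)) ^ 2 := by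
  have hs : Measurable fun x => f x + g x := hf.add hg
  have hsb : ∀ x, |f x + g x| ≤ Cf + Cg := fun x => (abs_add_le _ _).trans (add_le_add (hCf x) (hCg x))
  set A := ∫ x, ∫ y, f x * M x y * f y ∂μ ∂μ
  set B := ∫ x, ∫ y, f x * M x y * g y ∂μ ∂μ
  set C := ∫ x, ∫ y, g x * M x y * g y ∂μ ∂μ
  have hA : 0 ≤ A := hpsd f hf ⟨Cf, hCf⟩
  have hC : 0 ≤ C := hpsd g hg ⟨Cg, hCg⟩
  have hexp : ∫ x, ∫ y, (f x + g x) * M x y * (f y + g y) ∂μ ∂μ = A + 2 * B + C := by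
    rw [kform_add_left (μ := μ) hM hMb hf hCf hg hCg hs hsb, kform_comm (μ := μ) hM hMb hsymm hf hCf hs hsb, kform_comm (μ := μ) hM hMb hsymm hg hCg hs hsb,
      kform_add_left (μ := μ) hM hMb hf hCf hg hCg hf hCf, kform_add_left (μ := μ) hM hMb hf hCf hg hCg hg hCg, kform_comm (μ := μ) hM hMb hsymm hg hCg hf hCf]
    ring
  have hCS := kform_sq_le (μ := μ) hM hMb hsymm hpsd hf hCf hg hCg
  have hB : B ≤ Real.sqrt A * Real.sqrt C := by
    have h1 : B ≤ |B| := le_abs_self _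
    have h2 : |B| = Real.sqrt (B ^ 2) := (Real.sqrt_sq_eq_abs B).symm
    have h3 : Real.sqrt (B ^ 2) ≤ Real.sqrt (A * C) := Real.sqrt_le_sqrt hCS
    rw [Real.sqrt_mul hA] at h3
    linarith
  rw [hexp, add_sq, Real.sq_sqrt hA, Real.sq_sqrt hC]
  nlinarith [hB]

/-- ★★ **Three-term seminorm triangle**: `∫∫ (f+g+h)M(f+g+h) ≤ (√B(f) + √B(g) + √B(h))²`. [folklore] -/
theorem kform_add_three_le {f g h : X → ℝ} (hf : Measurable f) {Cf : ℝ} (hCf : ∀ x, |f x| ≤ Cf) (hg : Measurable g) {Cg : ℝ} (hCg : ∀ x, |g x| ≤ Cg)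
    (hh : Measurable h) {Ch : ℝ} (hCh : ∀ x, |h x| ≤ Ch) :
    ∫ x, ∫ y, (f x + g x + h x) * M x y * (f y + g y + h y) ∂μ ∂μ ≤
      (Real.sqrt (∫ x, ∫ y, f x * M x y * f y ∂μ ∂μ) + Real.sqrt (∫ x, ∫ y, g x * M x y * g y ∂μ ∂μ) + Real.sqrt (∫ x, ∫ y, h x * M x y * h y ∂μ ∂μ)) ^ 2 := by
  have hs : Measurable fun x => f x + g x := hf.add hg
  have hsb : ∀ x, |f x + g x| ≤ Cf + Cg := fun x => (abs_add_le _ _).trans (add_le_add (hCf x) (hCg x))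
  have h1 := kform_add_le (μ := μ) hM hMb hsymm hpsd hs hsb hh hCh
  have h2 := kform_add_le (μ := μ) hM hMb hsymm hpsd hf hCf hg hCg
  have h0 : 0 ≤ ∫ x, ∫ y, (f x + g x) * M x y * (f y + g y) ∂μ ∂μ := hpsd _ hs ⟨_, hsb⟩
  have hsf : 0 ≤ Real.sqrt (∫ x, ∫ y, f x * M x y * f y ∂μ ∂μ) := Real.sqrt_nonneg _
  have hsg : 0 ≤ Real.sqrt (∫ x, ∫ y, g x * M x y * g y ∂μ ∂μ) := Real.sqrt_nonneg _
  have h3 : Real.sqrt (∫ x, ∫ y, (f x + g x) * M x y * (f y + g y) ∂μ ∂μ) ≤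
      Real.sqrt (∫ x, ∫ y, f x * M x y * f y ∂μ ∂μ) + Real.sqrt (∫ x, ∫ y, g x * M x y * g y ∂μ ∂μ) := by
    rw [← Real.sqrt_sq (add_nonneg hsf hsg)]; exact Real.sqrt_le_sqrt h2
  refine h1.trans ?_
  have hsh : 0 ≤ Real.sqrt (∫ x, ∫ y, h x * M x y * h y ∂μ ∂μ) := Real.sqrt_nonneg _
  have h4 : Real.sqrt (∫ x, ∫ y, (f x + g x) * M x y * (f y + g y) ∂μ ∂μ) + Real.sqrt (∫ x, ∫ y, h x * M x y * h y ∂μ ∂μ) ≤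
      Real.sqrt (∫ x, ∫ y, f x * M x y * f y ∂μ ∂μ) + Real.sqrt (∫ x, ∫ y, g x * M x y * g y ∂μ ∂μ) + Real.sqrt (∫ x, ∫ y, h x * M x y * h y ∂μ ∂μ) := by linarith
  exact pow_le_pow_left₀ (add_nonneg (Real.sqrt_nonneg _) hsh) h4 2

/-- The three-term triangle with given bounds: `B(f) ≤ a²`, `B(g) ≤ b²`, `B(h) ≤ c²` (`a,b,c ≥ 0`) ⇒ `B(f+g+h) ≤ (a+b+c)²`. [folklore] -/
theorem kform_add_three_le_of_le {f g h : X → ℝ} (hf : Measurable f) {Cf : ℝ} (hCf : ∀ x, |f x| ≤ Cf) (hg : Measurable g) {Cg : ℝ} (hCg : ∀ x, |g x| ≤ Cg)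
    (hh : Measurable h) {Ch : ℝ} (hCh : ∀ x, |h x| ≤ Ch) {a b c : ℝ} (ha : 0 ≤ a) (hb : 0 ≤ b) (hc : 0 ≤ c)
    (hfa : ∫ x, ∫ y, f x * M x y * f y ∂μ ∂μ ≤ a ^ 2) (hgb : ∫ x, ∫ y, g x * M x y * g y ∂μ ∂μ ≤ b ^ 2) (hhc : ∫ x, ∫ y, h x * M x y * h y ∂μ ∂μ ≤ c ^ 2) :
    ∫ x, ∫ y, (f x + g x + h x) * M x y * (f y + g y + h y) ∂μ ∂μ ≤ (a + b + c) ^ 2 := by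
  have h1 := kform_add_three_le (μ := μ) hM hMb hsymm hpsd hf hCf hg hCg hh hCh
  have hfa' : Real.sqrt (∫ x, ∫ y, f x * M x y * f y ∂μ ∂μ) ≤ a := by rw [← Real.sqrt_sq ha]; exact Real.sqrt_le_sqrt hfa
  have hgb' : Real.sqrt (∫ x, ∫ y, g x * M x y * g y ∂μ ∂μ) ≤ b := by rw [← Real.sqrt_sq hb]; exact Real.sqrt_le_sqrt hgb
  have hhc' : Real.sqrt (∫ x, ∫ y, h x * M x y * h y ∂μ ∂μ) ≤ c := by rw [← Real.sqrt_sq hc]; exact Real.sqrt_le_sqrt hhc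
  refine h1.trans (pow_le_pow_left₀ (by positivity) (add_le_add (add_le_add hfa' hgb') hhc') 2)

end Split

end Summit.QuantumFields.YangMills.Theorems.FemtoTransferGap.StiffDoor

end
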